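import Summits.HodgeConjecture.HodgeConjecture.Theorems.MarkmanPartnerTransportK3Sq2TypeHodgeOfCycleInducedGenerator
import Literature.AlgebraicGeometry.HodgeTheory.CorrespondenceTranspose
import Literature.AlgebraicGeometry.HodgeTheory.AlgebraicClassesGysinOneSpan

/-!
# Route MarkmanPartnerTransport · HC⁴ for a marked `K3^{[2]}`-type fourfold whose transcendental Hodge
# endomorphisms are generated by ONE ALGEBRAIC SELF-MAP — Markman-free (planner task T-P1AT-L1 «AUT-CYCLO»)

The `X`-side rung F4 of the route (`hodgeConjectureFor_of_cycleInducedGenerator`, prover gen 7: HC⁴(X) once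
`End_Hdg(T(X)_ℚ) = ℚ[t|_T]` for a rational, type-preserving, CYCLE-INDUCED endomorphism `t` of `H²(X(ℂ); ℂ)`)
is fed with the cheapest cycle there is: the transposed graph `ᵗΓ_u = (𝟙, u)_* 1 ∈ A⁴(X × X)` of an algebraic
self-map `u : X ⟶ X`, which acts on `H²(X(ℂ); ℂ)` as `u^*` (tree theorem `corrAction_transposeGraph_one`, Fulton
Prop. 16.1.2 (c)) and is algebraic (tree theorem `complexGysin_one_mem_algebraicClasses_codim`, Fulton §19.1).

* `exists_cycle_of_endomorphism` — `u^*` on `H²(X(ℂ); ℂ)` is cycle-induced in the F4 spelling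
  (`∃ Z ∈ A⁴(X × X), u^* = [Z]_*` for the complex orientations), for every smooth projective fourfold `X` and
  every `u : X ⟶ X`; fact-free.
* `hodgeConjectureFor_of_endomorphismGenerator` — **HC⁴(X) for a marked smooth projective `K3^{[2]}`-type `X`
  admitting an algebraic self-map `u : X ⟶ X` such that every rational Hodge endomorphism of `H²(X)` killing
  `N¹(X)` with transcendental image is a rational polynomial in `u^*` on `T(X)`** (`End_Hdg(T(X)_ℚ) = ℚ[u^*|_T]`),
  modulo {Verbitsky–Guan, O'Grady, `QInvAlgebraic`}; `…_of_charlesMarkman`: modulo {Verbitsky–Guan, O'Grady,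
  Charles–Markman 2013}. NO Markman 2024: the only cycles used are the graphs of the powers `uᵏ` (through
  `exists_corrAction_pow`) — contrast `hodgeConjectureFor_of_endomorphism_nonreal_of_three_facts` (gen 8), which
  reaches the CM-by-automorphism case through item #3 and Markman's algebraic isometries.

The case the planner asked for (memo ROUTE-P1AT §5 T-P1AT-L1, "AUT-CYCLO kernel theorem"): `X = F(Y_t)` of
`K3^{[2]}`-type with an AUTOMORPHISM `u` of finite order `n` acting on the symplectic form by a primitive root of
unity and `End_Hdg T(X) = ℚ[u^*]` (`= ℚ(ζ_n)`, CM) — every Hodge class in `Sym² T(X)` is a `ℚ`-combination of the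
graph classes of `uᵏ + u^{−k}`; here this is the instance `u` an isomorphism of the theorem (the hypothesis does
not require `u` invertible, nor `E` CM: a self-map generating a totally real `E` is equally admissible).

CONDITIONAL on the displayed named facts; no definition, no sorry, no new named fact. Prover seat
hodge-nonav-19652-p1 (gen 17), `--supports stmt-HodgeConjecture-19653`. Nothing here proves crux #5, the target or HC.

References: W. Fulton, *Intersection Theory* (1998) §16.1 Prop. 16.1.1–16.1.2, §19.1; B. Kahn, *Zeta and
L-functions of varieties and motives* (2020) §3.5 Example 3.47; M. Verbitsky, GAFA 6 (1996); K. O'Grady,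
*Higher-dimensional analogues of K3 surfaces* (2008); F. Charles–E. Markman, Compos. Math. 149 (2013) Thm. 1.1.
-/

noncomputable section

set_option linter.dupNamespace false

open Module CategoryTheory MonoidalCategory CartesianMonoidalCategory
open Literature.AlgebraicTopology.SingularHomology Literature.Geometry.Kaehler
open Literature.AlgebraicGeometry Literature.AlgebraicGeometry.Motives Literature.AlgebraicGeometry.HodgeTheory
open Literature.AlgebraicGeometry.Hyperkaehler Literature.AlgebraicGeometry.Surfaces
open Summit.HodgeConjecture.HodgeConjecture.Theorems.NikulinTwinTransport

namespace Summit.HodgeConjecture.HodgeConjecture.Theorems.MarkmanPartnerTransport.PartnerLattice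

/-- `MarkedK3Sq[X, φ, P, z]`: VERBATIM the `let MarkedK3Sq := …` binder of the route declarations of
MarkmanPartnerTransport (clauses (m1)–(m6)). Local notation only. -/
local notation3 (prettyPrint := false) "MarkedK3Sq[" X ", " φ ", " P ", " z "]" =>
  (((IsIntegralClass P ∧ ∀ Q : complexBetti X (2 * 4), IsIntegralClass Q → ∃ n : ℤ, Q = n • P) ∧
    (∀ c : complexBetti X 2, IsIntegralClass c ↔ ∃ v : K3HilbertIndex → ℤ, φ c = fun i => (v i : ℂ)) ∧
    (∀ a : complexBetti X 2, cupPowTwo a 4 = ((3 : ℂ) * (k3HilbertForm 2 (φ a) (φ a)) ^ 2) • P) ∧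
    (IsOfHodgeType 4 X 2 2 0 (LinearEquiv.symm φ z) ∧
      ∀ τ : complexBetti X 2, IsOfHodgeType 4 X 2 2 0 τ → ∃ t : ℂ, τ = t • LinearEquiv.symm φ z) ∧
    (∀ c : complexBetti X 2, IsOfHodgeType 4 X 2 1 1 c ↔
      (k3HilbertForm 2 (φ c) z = 0 ∧ k3HilbertForm 2 (φ c) (star z) = 0)) ∧
    (k3HilbertForm 2 z z = 0 ∧ 0 < (k3HilbertForm 2 (star z) z).re)))

variable {X : SchemeOver ℂ} {φ : complexBetti X 2 ≃ₗ[ℂ] (K3HilbertIndex → ℂ)} {P : complexBetti X (2 * 4)}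
  {z : K3HilbertIndex → ℂ}

/-! ### The pull-back along a self-map is cycle-induced -/

/-- **`u^*` on `H²(X(ℂ); ℂ)` is induced by an algebraic class on `X × X`** (`X` a smooth projective fourfold,
`u : X ⟶ X` any morphism): the transposed graph class `(𝟙, u)_* 1 ∈ H⁸((X × X)(ℂ); ℂ)` is algebraic
(`complexGysin_one_mem_algebraicClasses_codim`) and acts as `u^*` (`corrAction_transposeGraph_one`), in the
exact spelling `∃ Z ∈ A⁴(X × X), ∀ y, u^* y = [Z]_* y` of the F4 hypothesis `ht_cyc`. Fact-free.
[cite: Fulton1998, §16.1 Prop. 16.1.2 and §19.1] [cite: Kahn2020, §3.5.3 Example 3.47] -/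
theorem exists_cycle_of_endomorphism (hX : IsSmoothProjective 4 X) (u : X ⟶ X) :
    ∃ Z ∈ algebraicClasses (X ⊗ X) 4, ∀ y : complexBetti X 2,
      (complexBetti.map u 2).hom y = corrAction complexOrientationFamily hX hX (rfl : 2 + 2 * 4 = 2 + 2 * 4) Z y :=
  ⟨complexGysin complexOrientationFamily hX (IsSmoothProjective.tensor_holds hX hX) (lift (𝟙 X) u)
      (show 0 + 2 * (4 + 4) = 2 * 4 + 2 * 4 by norm_num) (singularCohomology.one ℂ (ComplexPoints X)),
    complexGysin_one_mem_algebraicClasses_codim complexOrientationFamily (rfl : 4 + 4 = 4 + 4) hX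
      (IsSmoothProjective.tensor_holds hX hX) (lift (𝟙 X) u) _,
    fun y => by rw [corrAction_transposeGraph_one complexOrientationFamily hX hX u (rfl : 2 + 2 * 4 = 2 + 2 * 4)]⟩

/-! ### HC⁴(X) from a generating self-map -/

/-- **HC⁴(X) for a marked `K3^{[2]}`-type fourfold whose transcendental Hodge endomorphisms are the rational
polynomials in `u^*` for an algebraic self-map `u : X ⟶ X`**, modulo {Verbitsky–Guan, O'Grady, `QInvAlgebraic`}:
`u^*` is rational (`IsRationalClass.pullback`), type-preserving (`IsOfHodgeType.map_endomorphism`) and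
cycle-induced (`exists_cycle_of_endomorphism`), so the `X`-side F4 `hodgeConjectureFor_of_cycleInducedGenerator`
applies. Markman 2024 is NOT used. [cite: Fulton1998, §16.1 Prop. 16.1.1–16.1.2] [cite: Varesco2023, §2 (p. 8)] -/
theorem hodgeConjectureFor_of_endomorphismGenerator
    (hV : VerbitskyGuan_cohomology_K3HilbertSquareType) (hO : OGrady2008_dualBBFClass_algebraic)
    (hQ : QInvAlgebraic) (hX : IsSmoothProjective 4 X) (hK : IsOfK3HilbertSquareType X) (hM : MarkedK3Sq[X, φ, P, z])
    (u : X ⟶ X)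
    (hgen : ∀ f : complexBetti X 2 →ₗ[ℂ] complexBetti X 2, (∀ y, IsRationalClass y → IsRationalClass (f y)) →
      (∀ (i j : ℕ) y, IsOfHodgeType 4 X 2 i j y → IsOfHodgeType 4 X 2 i j (f y)) →
      (∀ d : complexBetti X 2, d ∈ algebraicClasses X 1 → f d = 0) →
      (∀ y : complexBetti X 2, ∀ d : complexBetti X 2, d ∈ algebraicClasses X 1 →
        k3HilbertForm 2 (φ (f y)) (φ d) = 0) →
      ∃ (n : ℕ) (a : Fin n → ℚ), ∀ y : complexBetti X 2,
        (∀ d : complexBetti X 2, d ∈ algebraicClasses X 1 → k3HilbertForm 2 (φ y) (φ d) = 0) →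
        f y = ∑ i : Fin n, ((a i : ℂ) • ((complexBetti.map u 2).hom ^ (i : ℕ)) y)) :
    HodgeConjectureFor 4 X :=
  hodgeConjectureFor_of_cycleInducedGenerator hV hO hQ hX hK hM (complexBetti.map u 2).hom
    (fun _ hy => hy.pullback _) (fun _ _ _ hy => hy.map_endomorphism hX u) (exists_cycle_of_endomorphism hX u) hgen

/-- **The same from the route's published facts** — modulo {Verbitsky–Guan, O'Grady, Charles–Markman 2013}
(`QInvAlgebraic` by `qInvAlgebraic_of_charlesMarkman`). In particular (planner task T-P1AT-L1): a marked smooth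
projective `K3^{[2]}`-type `X` with an automorphism `u` of finite order such that `End_Hdg T(X)_ℚ = ℚ[u^*|_T]`
(complex multiplication by `ℚ(ζ_n)` GENERATED BY THE AUTOMORPHISM) satisfies HC⁴(X) without Markman's theorem —
the base case over which the cell's incidence-seed programme spreads. CONDITIONAL; credits nothing; crux #5
stays open. [cite: CharlesMarkman2013, Thm. 1.1 (§1)] [cite: Fulton1998, §16.1 Prop. 16.1.1–16.1.2] -/
theorem hodgeConjectureFor_of_endomorphismGenerator_of_charlesMarkman
    (hV : VerbitskyGuan_cohomology_K3HilbertSquareType) (hO : OGrady2008_dualBBFClass_algebraic)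
    (hB : CharlesMarkman2013_lefschetzStandard_K3HilbertType)
    (hX : IsSmoothProjective 4 X) (hK : IsOfK3HilbertSquareType X) (hM : MarkedK3Sq[X, φ, P, z]) (u : X ⟶ X)
    (hgen : ∀ f : complexBetti X 2 →ₗ[ℂ] complexBetti X 2, (∀ y, IsRationalClass y → IsRationalClass (f y)) →
      (∀ (i j : ℕ) y, IsOfHodgeType 4 X 2 i j y → IsOfHodgeType 4 X 2 i j (f y)) →
      (∀ d : complexBetti X 2, d ∈ algebraicClasses X 1 → f d = 0) →
      (∀ y : complexBetti X 2, ∀ d : complexBetti X 2, d ∈ algebraicClasses X 1 →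
        k3HilbertForm 2 (φ (f y)) (φ d) = 0) →
      ∃ (n : ℕ) (a : Fin n → ℚ), ∀ y : complexBetti X 2,
        (∀ d : complexBetti X 2, d ∈ algebraicClasses X 1 → k3HilbertForm 2 (φ y) (φ d) = 0) →
        f y = ∑ i : Fin n, ((a i : ℂ) • ((complexBetti.map u 2).hom ^ (i : ℕ)) y)) :
    HodgeConjectureFor 4 X :=
  hodgeConjectureFor_of_endomorphismGenerator hV hO (qInvAlgebraic_of_charlesMarkman hV hB) hX hK hM u hgen

end Summit.HodgeConjecture.HodgeConjecture.Theorems.MarkmanPartnerTransport.PartnerLattice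

end
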